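import Summits.QuantumFields.YangMills.Theorems.SqueezedSkewnessFemtoCeiling

/-!
# Crux `BalabanLadder.NT` (stmt-QuantumFields-19353), LINE τ «typical currency» (planner ym-idea-6 g14, published skeleton
# `Cruxes/NT/Lines/typical_currency_birth.lean` rev 2; critic idea-crit-9 VERDICT #72 PASS-WITH-PRICE):
# support T3 `stub_ceilingOfPairCollar : pre PairCollar6 → FemtoQrpCeiling`, PROVED

The femto `Qrp` ceiling of route `SqueezedSkewness` (item 23547 `FemtoCeiling`, landed `FemtoCeilingProof.femtoCeiling_proof` from the
`∀`-exterior boundary law `FBL6` via `stub_collar6 : FBL6 → MomentBounds6`) re-read in the TYPICAL CURRENCY: its only use of `MomentBounds6`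
is the `n = 2` instance (`abs_cov_plane_le`), so the same proof runs from `PairCollar6 G r a` (= `MomentBounds6` with `n := 2`, verbatim).
§1 = the two pair lemmas of `FemtoCeilingProof` with the hypothesis retyped to `n = 2` (`abs_cov_plane_le₂`, `abs_cov_dens_reflect_le₂`);
§2 = `femtoQrpCeiling_of_pairCollar6`, the body of `femtoCeiling_proof` verbatim with `stub_collar6 … hFBL` replaced by the hypothesis —
its statement is `__Registered.stub_ceilingOfPairCollar` of the skeleton with the abbreviations `PairCollar6` / `FemtoQrpCeiling` unfolded
(byte-identical bodies; the skeleton closes its stub by `exact femtoQrpCeiling_of_pairCollar6`).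

HONEST FRAMING: a conditional support (the pair collar is a hypothesis); no crux, NT statement, rung or summit is proved; the Yang–Mills
mass gap is NOT proved.  Cell `ym-idea-1`, LEAD seat `ym-line-sfw-p2` g71 (free hands), `--supports stmt-QuantumFields-19353 --as helper`.
Proof text adapted from `Theorems/SqueezedSkewnessFemtoCeiling.lean` (fleet lead ym-spine-19353-p1 g19). [folklore]
-/

set_option autoImplicit false

noncomputable section
open MeasureTheory Filter Topology
open Literature.MathematicalPhysics.QuantumFieldTheory Literature.MathematicalPhysics.QuantumLattice
open Literature.Probability.LatticeModels (box)
open Summit.QuantumFields.YangMills.Cruxes.OSLegsFromFemtoAndGap.DlrCollarTransfer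
open Summit.QuantumFields.YangMills.Theorems.ThermalDescentTorusDictionary (eF aF wF zOf ccZ sum_box_eq_sum_fin)
open Summit.QuantumFields.YangMills.Theorems.AntipodalMarkovDictionary (covF_toFin_reflF toFin_dens_zOf)
open Summit.QuantumFields.YangMills.Cruxes.UniversalDetectorPlaneTight (cov_sum_mul_sum cov_dens_mul_dens_cfgReflect_eq_sum)
open Summit.QuantumFields.YangMills.Cruxes.NT.ConjugateResponse (torusE_comp_cfgReflect)
open Summit.QuantumFields.YangMills.Cruxes.UniversalDetectorLimitExtraction (latticeRiemannBound)
open Summit.QuantumFields.YangMills.Cruxes.NT.Reference (eventually_le_of_tendsto div_pow_depth_le)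
open Summit.QuantumFields.YangMills.Cruxes.NT.MarkovMirror (torusE_const_mul)

open Summit.QuantumFields.YangMills.Theorems.FemtoCeilingProof (exists_abs_le_decay sum_abs_translate_le window_of_ne_zero sep_charged)

namespace Summit.QuantumFields.YangMills.Theorems.CeilingOfPairCollar

variable (G : Type) [Group G] [TopologicalSpace G] [IsTopologicalGroup G] [CompactSpace G]
  [MeasurableSpace G] [BorelSpace G] (r : LatticeRep G)

/-! ## §1 The pair lemmas with the `n = 2` hypothesis -/

/-- `abs_cov_plane_le` of `FemtoCeilingProof` with the collar hypothesis retyped to its `n = 2` instance. [folklore] -/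
theorem abs_cov_plane_le₂ (β : ℝ) (L : ℕ) {C : ℝ} {R : ℕ}
    (H : ∀ (q : Fin 2 → Fin 4 × Fin 4) (x : Fin 2 → (Fin 4 → ℤ)), (∀ i, (q i).1 < (q i).2) →
      (∀ i j : Fin 2, i ≠ j → ∃ k : Fin 4,
        (2 * (R : ℤ) + 4) ≤ |((((x i k - x j k : ℤ) : ZMod (2 * L + 1))).valMinAbs : ℤ)|) →
      |torusE G r β L (fun U => ∏ i, (plane G r (q i) (x i) U - torusE G r β L (plane G r (q i) (x i))))| ≤
        (C / (R : ℝ) ^ 4) ^ 2)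
    (p q : {q : Fin 4 × Fin 4 // q.1 < q.2}) (X Y : Fin 4 → ℤ)
    (hsep : (2 * (R : ℤ) + 4) ≤ |((((X 0 - Y 0 : ℤ) : ZMod (2 * L + 1))).valMinAbs : ℤ)|) :
    |torusE G r β L (fun V => plane G r p.1 X V * plane G r q.1 Y V) -
        torusE G r β L (plane G r p.1 X) * torusE G r β L (plane G r q.1 Y)| ≤ (C / (R : ℝ) ^ 4) ^ 2 := by
  have hsep' : ∀ i j : Fin 2, i ≠ j → ∃ m : Fin 4, (2 * (R : ℤ) + 4) ≤
      |((((![X, Y] i m - ![X, Y] j m : ℤ) : ZMod (2 * L + 1))).valMinAbs : ℤ)| := by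
    intro i j hij
    fin_cases i <;> fin_cases j
    · exact absurd rfl hij
    · exact ⟨0, by simpa using hsep⟩
    · refine ⟨0, ?_⟩
      have h : ((Y 0 - X 0 : ℤ) : ZMod (2 * L + 1)) = -((X 0 - Y 0 : ℤ) : ZMod (2 * L + 1)) := by push_cast; ring
      have hk' : (2 * (R : ℤ) + 4) ≤ |((((Y 0 - X 0 : ℤ) : ZMod (2 * L + 1))).valMinAbs : ℤ)| := by
        rw [h, Int.abs_eq_natAbs, ZMod.natAbs_valMinAbs_neg, ← Int.abs_eq_natAbs]
        exact hsep
      simpa using hk'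
    · exact absurd rfl hij
  have h := H ![p.1, q.1] ![X, Y] (fun i => by fin_cases i <;> simp [p.2, q.2]) hsep'
  have hprod : (fun U => ∏ i : Fin 2, (plane G r (![p.1, q.1] i) (![X, Y] i) U -
      torusE G r β L (plane G r (![p.1, q.1] i) (![X, Y] i)))) =
      fun U => (plane G r p.1 X U - torusE G r β L (plane G r p.1 X)) *
        (plane G r q.1 Y U - torusE G r β L (plane G r q.1 Y)) := by
    funext U
    rw [Fin.prod_univ_two]
    simp
  rw [hprod, Summit.QuantumFields.YangMills.Cruxes.NT.CumulantPolarisation.torusE_centred_centred G r β L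
    (continuous_plane r _ _) (continuous_plane r _ _)] at h
  have e : torusE G r β L (fun U => plane G r p.1 X U * plane G r q.1 Y U) -
        torusE G r β L (plane G r q.1 Y) * torusE G r β L (plane G r p.1 X) -
        torusE G r β L (plane G r p.1 X) * torusE G r β L (plane G r q.1 Y) +
        torusE G r β L (plane G r p.1 X) * torusE G r β L (plane G r q.1 Y) =
      torusE G r β L (fun U => plane G r p.1 X U * plane G r q.1 Y U) -
        torusE G r β L (plane G r p.1 X) * torusE G r β L (plane G r q.1 Y) := by ring
  rwa [e] at h

/-- `abs_cov_dens_reflect_le` of `FemtoCeilingProof` with the collar hypothesis retyped to its `n = 2` instance. [folklore] -/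
theorem abs_cov_dens_reflect_le₂ (β : ℝ) (L : ℕ) {C : ℝ} {R : ℕ}
    (H : ∀ (q : Fin 2 → Fin 4 × Fin 4) (x : Fin 2 → (Fin 4 → ℤ)), (∀ i, (q i).1 < (q i).2) →
      (∀ i j : Fin 2, i ≠ j → ∃ k : Fin 4,
        (2 * (R : ℤ) + 4) ≤ |((((x i k - x j k : ℤ) : ZMod (2 * L + 1))).valMinAbs : ℤ)|) →
      |torusE G r β L (fun U => ∏ i, (plane G r (q i) (x i) U - torusE G r β L (plane G r (q i) (x i))))| ≤
        (C / (R : ℝ) ^ 4) ^ 2)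
    (X Y : Fin 4 → ℤ)
    (hsep : ∀ q : {q : Fin 4 × Fin 4 // q.1 < q.2}, (2 * (R : ℤ) + 4) ≤
      |((((X 0 - (if q.1.1 = 0 then siteReflect Y - Pi.single 0 1
        else siteReflect Y) 0 : ℤ) : ZMod (2 * L + 1))).valMinAbs : ℤ)|) :
    |torusE G r β L (fun V => dens G r X V * dens G r Y (cfgReflect V)) -
        torusE G r β L (dens G r X) * torusE G r β L (dens G r Y)| ≤ 36 * (C / (R : ℝ) ^ 4) ^ 2 := by
  rw [cov_dens_mul_dens_cfgReflect_eq_sum r β L X Y]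
  refine (Finset.abs_sum_le_sum_abs _ _).trans ?_
  have h1 : ∀ p ∈ (Finset.univ : Finset {q : Fin 4 × Fin 4 // q.1 < q.2}),
      |∑ q : {q : Fin 4 × Fin 4 // q.1 < q.2}, (torusE G r β L (fun V => plane G r p.1 X V *
          plane G r q.1 (if q.1.1 = 0 then siteReflect Y - Pi.single 0 1
            else siteReflect Y) V) -
        torusE G r β L (plane G r p.1 X) * torusE G r β L (plane G r q.1
          (if q.1.1 = 0 then siteReflect Y - Pi.single 0 1
            else siteReflect Y)))| ≤ 6 * (C / (R : ℝ) ^ 4) ^ 2 := by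
    intro p _
    refine (Finset.abs_sum_le_sum_abs _ _).trans ?_
    have h2 : ∀ q ∈ (Finset.univ : Finset {q : Fin 4 × Fin 4 // q.1 < q.2}),
        |torusE G r β L (fun V => plane G r p.1 X V *
            plane G r q.1 (if q.1.1 = 0 then siteReflect Y - Pi.single 0 1
              else siteReflect Y) V) -
          torusE G r β L (plane G r p.1 X) * torusE G r β L (plane G r q.1
            (if q.1.1 = 0 then siteReflect Y - Pi.single 0 1
              else siteReflect Y))| ≤ (C / (R : ℝ) ^ 4) ^ 2 :=
      fun q _ => abs_cov_plane_le₂ G r β L H p q X _ (hsep q)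
    refine (Finset.sum_le_sum h2).trans ?_
    rw [Finset.sum_const, Finset.card_univ, show Fintype.card {q : Fin 4 × Fin 4 // q.1 < q.2} = 6 by decide,
      nsmul_eq_mul]
    norm_num
  refine (Finset.sum_le_sum h1).trans ?_
  rw [Finset.sum_const, Finset.card_univ, show Fintype.card {q : Fin 4 × Fin 4 // q.1 < q.2} = 6 by decide,
    nsmul_eq_mul]
  norm_num
  exact le_of_eq (by ring)
/-! ## §2 T3: the femto `Qrp` ceiling from the pair collar -/

/-- **T3 `stub_ceilingOfPairCollar` of LINE τ** (= the skeleton's `__Registered.stub_ceilingOfPairCollar` with `PairCollar6` /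
`FemtoQrpCeiling` unfolded): in any unit `(G, r, a)` (`0 < a → 0`) carrying the `n = 2` collar output, every femto translate `g = v(· + a k e₀)`
of a slab bump `v` whose lower edge stays `≥ h_c > 0` has `Qrp(g) ≤ C` on every large hypercube, `C` independent of `β, L, k`.  The body of
`FemtoCeilingProof.femtoCeiling_proof` verbatim, fed by the hypothesis instead of `stub_collar6`. [folklore] -/
theorem femtoQrpCeiling_of_pairCollar6 :
    ∀ (G : Type) [Group G] [TopologicalSpace G] [IsTopologicalGroup G] [CompactSpace G],
      Literature.MathematicalPhysics.QuantumFieldTheory.IsCompactSimpleLieGroup G → letI : MeasurableSpace G := borel G;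
      haveI : BorelSpace G := ⟨rfl⟩; ∀ (r : Literature.MathematicalPhysics.QuantumFieldTheory.LatticeRep G) (a : ℝ → ℝ),
      (∀ β, 0 < a β) → Filter.Tendsto a Filter.atTop (nhds 0) →
      (∃ (C β₄ ℓ₄ : ℝ), 0 < ℓ₄ ∧ 0 ≤ C ∧ ∀ β : ℝ, β₄ ≤ β → ∀ (L : ℕ) (q : Fin 2 → Fin 4 × Fin 4) (x : Fin 2 → (Fin 4 → ℤ)) (R : ℕ), (∀ i, (q i).1 < (q i).2) → 1 ≤ R → (R : ℝ) * a β ≤ ℓ₄ → 4 * R + 8 ≤ L → (∀ i j : Fin 2, i ≠ j → ∃ k : Fin 4, (2 * (R : ℤ) + 4) ≤ |((((x i k - x j k : ℤ) : ZMod (2 * L + 1))).valMinAbs : ℤ)|) → |torusE G r β L (fun U => ∏ i, (plane G r (q i) (x i) U - torusE G r β L (plane G r (q i) (x i))))| ≤ (C / (R : ℝ) ^ 4) ^ 2) →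
      (let St : ℕ → ℕ → Type := fun S T => Literature.MathematicalPhysics.QuantumFieldTheory.FinTorusSite S S S T; let Cfg : ℕ → ℕ → Type := fun S T => Literature.MathematicalPhysics.QuantumFieldTheory.FinTorusSite S S S T × Fin 4 → G; let cc : (n : ℕ) → Fin n → ℤ := fun n i => if 2 * i.val < n then (i.val : ℤ) else (i.val : ℤ) - n; let posE : (S T : ℕ) → St S T → EuclideanSpace ℝ (Fin 4) := fun S T x => Literature.MathematicalPhysics.QuantumLattice.siteToE (d := 4) ![cc T x.2.2.2, cc S x.1, cc S x.2.1, cc S x.2.2.1]; let P : (S T : ℕ) → St S T → Fin 4 → Fin 4 → Cfg S T → ℝ := fun _ _ x i j U => (r.ρ (Literature.MathematicalPhysics.QuantumFieldTheory.finTorusPlaquette U x i j)).trace.re; let A : (S T : ℕ) → St S T → Cfg S T → ℝ := fun S T x U => ∑ q : {q : Fin 4 × Fin 4 // q.1 < q.2}, P S T x q.1.1 q.1.2 U; let w : ℝ → (S T : ℕ) → Cfg S T → ℝ := fun β S T U => Real.exp (-β * ∑ x : St S T, ∑ q : {q : Fin 4 × Fin 4 // q.1 < q.2}, ((r.N : ℝ)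 - P S T x q.1.1 q.1.2 U)); let E : ℝ → (S T : ℕ) → (Cfg S T → ℝ) → ℝ := fun β S T F => (∫ U : Literature.MathematicalPhysics.QuantumFieldTheory.FinTorusSite S S S T × Fin 4 → G, F U * w β S T U ∂MeasureTheory.Measure.pi (fun _ => Literature.MathematicalPhysics.QuantumFieldTheory.haarProbability G)) / Literature.MathematicalPhysics.QuantumFieldTheory.wilsonFinTorusPartition r.ρ β S S S T; let Cov : ℝ → (S T : ℕ) → (Cfg S T → ℝ) → (Cfg S T → ℝ) → ℝ := fun β S T F F' => E β S T (fun U => F U * F' U) - E β S T F * E β S T F'; let refl : (S T : ℕ) → Cfg S T → Cfg S T := fun _ T U e => if e.2 = Fin.last 3 then (U ((e.1.1, e.1.2.1, e.1.2.2.1, Fin.rev e.1.2.2.2), Fin.last 3))⁻¹ else U ((e.1.1, e.1.2.1, e.1.2.2.1, ⟨(T - e.1.2.2.2.val) % T, Nat.mod_lt _ e.1.2.2.2.pos⟩), e.2); let B : (S T : ℕ) → ℝ → SchwartzMap (EuclideanSpace ℝ (Fin 4)) ℝ → Cfg S T → ℝ := fun S T s f U => ∑ x : St S T, f (s • posE S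 T x) * A S T x U; let Qrp : ℝ → (S T : ℕ) → ℝ → SchwartzMap (EuclideanSpace ℝ (Fin 4)) ℝ → ℝ := fun β S T s f => Cov β S T (fun U => B S T s f (refl S T U)) (B S T s f); ∀ (v : SchwartzMap (EuclideanSpace ℝ (Fin 4)) ℝ) (ρ δ₁ δ₂ hc : ℝ), 0 < hc → tsupport (v : EuclideanSpace ℝ (Fin 4) → ℝ) ⊆ Metric.closedBall (EuclideanSpace.single (0 : Fin 4) (1 : ℝ)) ρ → tsupport v ⊆ {y : EuclideanSpace ℝ (Fin 4) | δ₁ < y 0 ∧ y 0 < δ₂} → ∃ (C β₆ Λ₆ : ℝ), ∀ β : ℝ, β₆ ≤ β → ∀ L : ℕ, Λ₆ ≤ a β * L → ∀ (k : ℕ) (g : SchwartzMap (EuclideanSpace ℝ (Fin 4)) ℝ), hc ≤ δ₁ - a β * k → (∀ y, g y = v (y + (a β * k) • EuclideanSpace.single (0 : Fin 4) (1 : ℝ))) → Qrp β (2 * L + 1) (2 * L + 1) (a β) g ≤ C) := by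
  intro G _ _ _ _ hG r a ha ha0 hPC
  letI : MeasurableSpace G := borel G
  haveI : BorelSpace G := ⟨rfl⟩
  haveI := r.secondCountableTopology
  dsimp only
  intro v ρ δ₁ δ₂ hc hhc hvball hvslab
  -- the collar output from the boundary law, the decay of the bump
  obtain ⟨C, β₄, ℓ₄, hℓ₄, hC0, hMB⟩ := hPC
  obtain ⟨Kv, hKv0, hKv⟩ := exists_abs_le_decay v
  -- constants
  obtain ⟨c₀, hc₀⟩ : ∃ c₀ : ℝ, c₀ = min (hc / 4) ℓ₄ := ⟨_, rfl⟩
  have hc₀0 : 0 < c₀ := by rw [hc₀]; exact lt_min (by positivity) hℓ₄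
  have hc₀hc : c₀ ≤ hc / 4 := by rw [hc₀]; exact min_le_left _ _
  set K' : ℝ := Kv * (1 + |δ₁|) ^ 8 * 4 ^ 4 with hK'
  have hK'0 : 0 ≤ K' := by rw [hK']; positivity
  obtain ⟨βa, hβa⟩ := eventually_le_of_tendsto ha0 (δ := min (c₀ / 2) (min (3 * hc / 8) 1))
    (lt_min (by positivity) (lt_min (by positivity) one_pos))
  refine ⟨K' ^ 2 * (36 * (C ^ 2 * (2 / c₀) ^ 8)), max β₄ βa, max (2 * |δ₂| + 1) (4 * c₀ + 8), fun β hβ L hL k g hk hg => ?_⟩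
  have hβ₄ : β₄ ≤ β := le_trans (le_max_left _ _) hβ
  have hs : 0 < a β := ha β
  have hsa := hβa β (le_trans (le_max_right _ _) hβ)
  have hsc : a β ≤ c₀ / 2 := hsa.trans (min_le_left _ _)
  have hsh : a β ≤ 3 * hc / 8 := hsa.trans ((min_le_right _ _).trans (min_le_left _ _))
  have hs1 : a β ≤ 1 := hsa.trans ((min_le_right _ _).trans (min_le_right _ _))
  have hLδ : 2 * |δ₂| + 1 ≤ a β * L := (le_max_left _ _).trans hL
  have hLc : 4 * c₀ + 8 ≤ a β * L := (le_max_right _ _).trans hL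
  -- the collar radius
  obtain ⟨R, hRdef⟩ : ∃ R : ℕ, R = ⌊c₀ / a β⌋₊ := ⟨_, rfl⟩
  have hRle : (R : ℝ) ≤ c₀ / a β := by rw [hRdef]; exact Nat.floor_le (by positivity)
  have hRlt : c₀ / a β < R + 1 := by rw [hRdef]; exact Nat.lt_floor_add_one _
  have hc2 : 2 ≤ c₀ / a β := by rw [le_div_iff₀ hs]; linarith
  have hR1 : 1 ≤ R := by exact_mod_cast (show (1 : ℝ) ≤ R by linarith)
  have hRc : (R : ℝ) * a β ≤ c₀ := by rwa [le_div_iff₀ hs] at hRle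
  have hRs : (R : ℝ) * a β ≤ ℓ₄ := hRc.trans (by rw [hc₀]; exact min_le_right _ _)
  have hRL : 4 * R + 8 ≤ L := by
    have h1 : ((4 * R + 8 : ℕ) : ℝ) * a β ≤ (L : ℝ) * a β := by push_cast; nlinarith
    exact_mod_cast le_of_mul_le_mul_right h1 hs
  have hRsep : (2 * R + 4 : ℝ) ≤ 2 * hc / a β := by
    rw [le_div_iff₀ hs]; nlinarith
  have hRhalf : c₀ / 2 / a β ≤ R := by
    rw [div_div, show c₀ / (2 * a β) = c₀ / a β / 2 by rw [div_div, mul_comm]]; linarith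
  -- the `n = 2` collar output at this coupling / torus / radius
  have H : ∀ (q : Fin 2 → Fin 4 × Fin 4) (x : Fin 2 → (Fin 4 → ℤ)), (∀ i, (q i).1 < (q i).2) →
      (∀ i j : Fin 2, i ≠ j → ∃ k : Fin 4,
        (2 * (R : ℤ) + 4) ≤ |((((x i k - x j k : ℤ) : ZMod (2 * L + 1))).valMinAbs : ℤ)|) →
      |torusE G r β L (fun U => ∏ i, (plane G r (q i) (x i) U - torusE G r β L (plane G r (q i) (x i))))| ≤
        (C / (R : ℝ) ^ 4) ^ 2 :=
    fun q x hq hsep => hMB β hβ₄ L q x R hq hR1 hRs hRL hsep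
  -- the weights and the `ℤ⁴` observable
  set s : ℝ := a β with hsdef
  set c : FinTorusSite (2 * L + 1) (2 * L + 1) (2 * L + 1) (2 * L + 1) → ℝ :=
    fun u => g (s • siteToE (zOf (2 * L + 1) u)) with hcdef
  have hcv : ∀ u, c u = v (s • siteToE (zOf (2 * L + 1) u) + (s * k) • EuclideanSpace.single (0 : Fin 4) (1 : ℝ)) := by
    intro u; rw [hcdef]; dsimp only; rw [hg, mul_smul]
  -- Σ |c| ≤ K'/s⁴
  have hsk : s * (k : ℝ) ≤ |δ₁| := by
    have : s * k ≤ δ₁ - hc := by linarith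
    linarith [le_abs_self δ₁]
  have hsumc : ∑ u, |c u| ≤ K' / s ^ 4 := by
    have hw : ‖(s * k) • EuclideanSpace.single (0 : Fin 4) (1 : ℝ)‖ ≤ |δ₁| := by
      rw [norm_smul, PiLp.norm_single, norm_one, mul_one, Real.norm_of_nonneg (by positivity)]
      exact hsk
    simp only [hcv]
    refine (sum_abs_translate_le hKv0 hKv L hs hs1 _).trans ?_
    rw [hK', div_le_div_iff_of_pos_right (by positivity)]
    have : (1 + ‖(s * (k : ℝ)) • EuclideanSpace.single (0 : Fin 4) (1 : ℝ)‖) ^ 8 ≤ (1 + |δ₁|) ^ 8 :=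
      pow_le_pow_left₀ (by positivity) (by linarith) 8
    nlinarith [pow_nonneg (show (0:ℝ) ≤ 4 by norm_num) 4]
  -- the per-pair bound
  have hpair : ∀ x y : FinTorusSite (2 * L + 1) (2 * L + 1) (2 * L + 1) (2 * L + 1),
      |c x * c y * (torusE G r β L (fun V => dens G r (zOf (2 * L + 1) y) V * dens G r (zOf (2 * L + 1) x) (cfgReflect V)) -
        torusE G r β L (dens G r (zOf (2 * L + 1) y)) * torusE G r β L (dens G r (zOf (2 * L + 1) x)))| ≤
      |c x| * |c y| * (36 * (C / (R : ℝ) ^ 4) ^ 2) := by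
    intro x y
    rw [abs_mul, abs_mul]
    by_cases hx : c x = 0
    · rw [hx]; simp
    by_cases hy : c y = 0
    · rw [hy]; simp
    refine mul_le_mul_of_nonneg_left ?_ (by positivity)
    rw [hcv] at hx hy
    have wx := window_of_ne_zero hvslab s (s * k) _ hx
    have wy := window_of_ne_zero hvslab s (s * k) _ hy
    refine abs_cov_dens_reflect_le₂ G r β L H _ _ fun q => ?_
    by_cases hq : q.1.1 = 0
    · rw [if_pos hq]
      exact sep_charged hs hs1 hk hLδ hRsep _ _ wx wy 1 (Or.inr rfl) _ (by simp; ring)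
    · rw [if_neg hq]
      exact sep_charged hs hs1 hk hLδ hRsep _ _ wx wy 0 (Or.inl rfl) _ (by simp)
  -- assembly: the route's `Qrp` is the mirror covariance of `Φ_g = Σ_u c_u · dens (zOf u)`
  obtain ⟨Φ, hΦ⟩ : ∃ Φ : LGConfig 4 G → ℝ, Φ = fun V => ∑ x, c x * dens G r (zOf (2 * L + 1) x) V := ⟨_, rfl⟩
  obtain ⟨f, hf⟩ : ∃ f : FinTorusSite (2 * L + 1) (2 * L + 1) (2 * L + 1) (2 * L + 1) → LGConfig 4 G → ℝ,
      f = fun x V => c x * dens G r (zOf (2 * L + 1) x) (cfgReflect V) := ⟨_, rfl⟩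
  obtain ⟨g', hg'⟩ : ∃ g' : FinTorusSite (2 * L + 1) (2 * L + 1) (2 * L + 1) (2 * L + 1) → LGConfig 4 G → ℝ,
      g' = fun x V => c x * dens G r (zOf (2 * L + 1) x) V := ⟨_, rfl⟩
  have hfc : ∀ x, Continuous (f x) := fun x => by
    rw [hf]; exact continuous_const.mul ((continuous_dens r _).comp
      Summit.QuantumFields.YangMills.Cruxes.NT.MarkovMirror.continuous_cfgReflect)
  have hgc : ∀ x, Continuous (g' x) := fun x => by rw [hg']; exact continuous_const.mul (continuous_dens r _)
  have hB : ∀ W : FinTorusSite (2 * L + 1) (2 * L + 1) (2 * L + 1) (2 * L + 1) × Fin 4 → G,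
      (∑ x, c x * aF r x W) =
        Φ (torusLift (2 * L + 1) (configPerm (finRotate 4) ((finTorusConfigEquivSite G (2 * L + 1)).symm W))) := by
    intro W
    rw [hΦ]
    exact Finset.sum_congr rfl fun x _ => by rw [← congrFun (toFin_dens_zOf (G := G) r L x) W]
  have e1 : (fun V => Φ (cfgReflect V) * Φ V) = fun V => (∑ x, f x V) * ∑ y, g' y V := by
    funext V; simp only [hΦ, hf, hg']
  have e2 : (fun V => Φ (cfgReflect V)) = fun V => ∑ x, f x V := by funext V; simp only [hΦ, hf]
  have e3 : Φ = fun V => ∑ y, g' y V := by funext V; simp only [hΦ, hg']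
  have hterm : ∀ x y : FinTorusSite (2 * L + 1) (2 * L + 1) (2 * L + 1) (2 * L + 1),
      torusE G r β L (fun V => f x V * g' y V) - torusE G r β L (f x) * torusE G r β L (g' y) =
      c x * c y * (torusE G r β L (fun V => dens G r (zOf (2 * L + 1) y) V * dens G r (zOf (2 * L + 1) x) (cfgReflect V)) -
        torusE G r β L (dens G r (zOf (2 * L + 1) y)) * torusE G r β L (dens G r (zOf (2 * L + 1) x))) := by
    intro x y
    have e4 : (fun V => f x V * g' y V) =
        fun V => (c x * c y) * (dens G r (zOf (2 * L + 1) y) V * dens G r (zOf (2 * L + 1) x) (cfgReflect V)) := by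
      funext V; simp only [hf, hg']; ring
    rw [e4, show f x = fun V => c x * dens G r (zOf (2 * L + 1) x) (cfgReflect V) by rw [hf],
      show g' y = fun V => c y * dens G r (zOf (2 * L + 1) y) V by rw [hg'],
      torusE_const_mul G r β L, torusE_const_mul G r β L, torusE_const_mul G r β L,
      torusE_comp_cfgReflect G r β L (dens G r (zOf (2 * L + 1) x))]
    ring
  have key : eF r β (2 * L + 1) (fun V => (∑ x, c x * aF r x (fun e => if e.2 = Fin.last 3 then (V ((e.1.1, e.1.2.1, e.1.2.2.1, Fin.rev e.1.2.2.2), Fin.last 3))⁻¹ else V ((e.1.1, e.1.2.1, e.1.2.2.1, ⟨((2 * L + 1) - e.1.2.2.2.val) % (2 * L + 1), Nat.mod_lt _ e.1.2.2.2.pos⟩), e.2))) * ∑ x, c x * aF r x V) -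
      eF r β (2 * L + 1) (fun V => ∑ x, c x * aF r x (fun e => if e.2 = Fin.last 3 then (V ((e.1.1, e.1.2.1, e.1.2.2.1, Fin.rev e.1.2.2.2), Fin.last 3))⁻¹ else V ((e.1.1, e.1.2.1, e.1.2.2.1, ⟨((2 * L + 1) - e.1.2.2.2.val) % (2 * L + 1), Nat.mod_lt _ e.1.2.2.2.pos⟩), e.2))) * eF r β (2 * L + 1) (fun V => ∑ x, c x * aF r x V) ≤
      K' ^ 2 * (36 * (C ^ 2 * (2 / c₀) ^ 8)) := by
    simp only [hB]
    rw [covF_toFin_reflF (G := G) r β L Φ Φ, e1, e2, e3, cov_sum_mul_sum r β L f g' hfc hgc]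
    refine (le_abs_self _).trans ((Finset.abs_sum_le_sum_abs _ _).trans ?_)
    have hrow : ∀ x ∈ (Finset.univ : Finset (FinTorusSite (2 * L + 1) (2 * L + 1) (2 * L + 1) (2 * L + 1))),
        |∑ y, (torusE G r β L (fun V => f x V * g' y V) - torusE G r β L (f x) * torusE G r β L (g' y))| ≤
        |c x| * (K' / s ^ 4) * (36 * (C / (R : ℝ) ^ 4) ^ 2) := by
      intro x _
      refine (Finset.abs_sum_le_sum_abs _ _).trans ?_
      simp only [hterm]
      refine (Finset.sum_le_sum fun y _ => hpair x y).trans ?_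
      rw [← Finset.sum_mul, ← Finset.mul_sum]
      exact mul_le_mul_of_nonneg_right (mul_le_mul_of_nonneg_left hsumc (abs_nonneg _)) (by positivity)
    refine (Finset.sum_le_sum hrow).trans ?_
    rw [← Finset.sum_mul, ← Finset.sum_mul]
    have hCR : C / (R : ℝ) ^ 4 ≤ C * (s / (c₀ / 2)) ^ 4 := div_pow_depth_le hC0 (by positivity) hs hRhalf
    have h36 : 36 * (C / (R : ℝ) ^ 4) ^ 2 ≤ 36 * (C * (s / (c₀ / 2)) ^ 4) ^ 2 :=
      mul_le_mul_of_nonneg_left (pow_le_pow_left₀ (by positivity) hCR 2) (by norm_num)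
    calc (∑ x, |c x|) * (K' / s ^ 4) * (36 * (C / (R : ℝ) ^ 4) ^ 2)
        ≤ (K' / s ^ 4) * (K' / s ^ 4) * (36 * (C * (s / (c₀ / 2)) ^ 4) ^ 2) :=
          mul_le_mul (mul_le_mul_of_nonneg_right hsumc (by positivity)) h36 (by positivity) (by positivity)
      _ = K' ^ 2 * (36 * (C ^ 2 * (2 / c₀) ^ 8)) := by field_simp
  exact key


end Summit.QuantumFields.YangMills.Theorems.CeilingOfPairCollar

end
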